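import Literature.NumberTheory.EllipticCurves.KatoFineSelmerFiniteProofs
import HarnessLib

/-!
# Graded Pontryagin duality for the dual fine Selmer datum: `(p^n Sel₀)[p]` finite ⟹ `p^n X₀ / p^{n+1} X₀` finite,
# and the graded Kummer reduction `(conj_γ − id)^J`-killing ⟹ `(p^n Sel₀)[p]` finite (theorems only; no named fact)

Topic `NumberTheory/EllipticCurves` (next to `KatoFineSelmerDualMuProofs`, `KatoFineSelmerFiniteProofs`);
namespaces `Literature.NumberTheory.EllipticCurves.IwasawaDual` (generic part) and `WeierstrassCurve`
(elliptic-curve part).  THEOREMS ONLY — nothing is asserted (D-0026).  Cell `bsd-f3-mu`, seat `-es`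
(planner-bsd-f3-mu-es-g4-0), HOME/es/Sketch5.lean Parts 1–2 verbatim; consumer:
`Summits/BirchSwinnertonDyer/Rank1Residual/SmallImageMu/GradedEulerLossCore.lean` (the graded discrete core
and its kernel link to the leaf `SmallImageMu.FineExponentLeEulerLossOnClassX9`).

* `IwasawaDual.toDual_C_pow_smul` — `(C p)^m` acts through `p^m` on the discrete side.
* `IwasawaDual.exists_eq_C_pow_smul_of_mem` / `C_pow_smul_mem` — membership in `(p)^n • ⊤`.
* `IwasawaDual.finite_gradedQuotient_of_finite` — for an axiomatic dual pair `toDual : X ≅ Hom(S, ℚ/ℤ)`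
  (`S` `p`-primary, constants through `ℤ_p → ℤ/p^k`): `{s : p•s = 0 ∧ s ∈ p^n S}` finite ⟹
  `p^n X ⧸ p^{n+1} X` finite (the case `n = 0` is `finite_quotient_pSmul_of_finite_pTorsion`).
* `WeierstrassCurve.FineSelmerDualData.finite_gradedQuotient_of_finite_gradedPTorsion` — the same for every
  dual fine Selmer datum `Y` (`augIdealP p = span {C p}`).
* `WeierstrassCurve.finite_fineSelmerInfty_gradedPTorsion_of_forall_iterate_eq_zero` — if `(conj_γ − id)^J`
  kills every `y ∈ H¹(K_∞, E[p])` whose image lies in `p^n · Sel₀(K_∞, E[p^∞])`, then `(p^n Sel₀)[p]` is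
  finite (graded form of `finite_fineSelmerInfty_pTorsion_of_forall_iterate_eq_zero`).

References: R. Greenberg, *Iwasawa theory for elliptic curves*, LNM 1716 (1999), §1 p. 60 (Pontryagin
duality of `Λ`-modules, `μ = 0 ⟺ X/pX` finite) [GreenbergLNM1716]; L. Washington, *Introduction to
Cyclotomic Fields*, §13.2 [Washington1997].
-/

noncomputable section

open scoped Classical

/-! ## Part 1 — graded exactness of axiomatic Pontryagin duality -/

namespace Literature.NumberTheory.EllipticCurves.IwasawaDual

section Graded

variable {p : ℕ} [Fact p.Prime]
variable {S : Type*} [AddCommGroup S]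
variable {X : Type*} [AddCommGroup X] [Module (PowerSeries ℤ_[p]) X]
variable {toDual : X →+ (S →+ AddCircle (1 : ℚ))}

/-- `(C p)^m` acts through multiplication by `p^m` on the discrete side:
`toDual ((C p)^m • x) t = toDual x (p^m • t)` (from the `toDual_C_smul` axiom on `p^k`-torsion classes).
[cite: GreenbergLNM1716, §1 p. 60 (after Conj. 1.3)] -/
theorem toDual_C_pow_smul
    (hC : ∀ (c : ℤ_[p]) (x : X) (s : S) (k : ℕ), p ^ k • s = 0 →
      toDual (PowerSeries.C c • x) s = (PadicInt.toZModPow k c).val • toDual x s)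
    (htor : ∀ s : S, ∃ k : ℕ, p ^ k • s = 0) (x : X) (t : S) (m : ℕ) :
    toDual ((PowerSeries.C (p : ℤ_[p])) ^ m • x) t = toDual x (p ^ m • t) := by
  obtain ⟨k, hk⟩ := htor t
  rw [← map_pow, ← Nat.cast_pow, hC _ x t k hk, map_nsmul]
  have hval : (PadicInt.toZModPow k ((p ^ m : ℕ) : ℤ_[p])).val ≡ p ^ m [MOD p ^ k] := by
    rw [map_natCast, ZMod.val_natCast]
    exact Nat.mod_modEq _ _
  have hps : p ^ k • toDual x t = 0 := by rw [← map_nsmul, hk, map_zero]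
  exact smul_eq_of_modEq hps hval

/-- Elements of `(p)^n · X` are `(C p)^n`-multiples (unfolding of `Iⁿ • ⊤` for the principal ideal `I = (p)`).
[cite: Washington1997, §13.2 (the ideals `(p^n)` of `Λ`)] -/
theorem exists_eq_C_pow_smul_of_mem {n : ℕ} {x : X}
    (hx : x ∈ (Ideal.span {PowerSeries.C (p : ℤ_[p])} ^ n • (⊤ : Submodule (PowerSeries ℤ_[p]) X))) :
    ∃ x' : X, x = (PowerSeries.C (p : ℤ_[p])) ^ n • x' := by
  rw [Ideal.span_singleton_pow, Submodule.ideal_span_singleton_smul,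
    Submodule.mem_smul_pointwise_iff_exists] at hx
  obtain ⟨x', -, hx'⟩ := hx
  exact ⟨x', hx'.symm⟩

/-- `(C p)^n`-multiples lie in `(p)^n · X`. [cite: Washington1997, §13.2 (the ideals `(p^n)` of `Λ`)] -/
theorem C_pow_smul_mem (n : ℕ) (x' : X) :
    (PowerSeries.C (p : ℤ_[p])) ^ n • x' ∈
      (Ideal.span {PowerSeries.C (p : ℤ_[p])} ^ n • (⊤ : Submodule (PowerSeries ℤ_[p]) X)) :=
  Submodule.smul_mem_smul (Ideal.pow_mem_pow (Ideal.mem_span_singleton_self _) n) Submodule.mem_top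

/-- **Graded exactness of Pontryagin duality: `(p^n S)[p]` finite ⟹ `p^n X / p^{n+1} X` finite** for an
axiomatic dual `toDual : X ≃ Hom(S, ℚ/ℤ)` (`S` `p`-primary, constants acting through `ℤ_p → ℤ/p^k`).
A class `z = p^n z' ∈ p^n X` is read on `(p^n S)[p]` through `s = p^n t ↦ z(t) = z'(s)`; if that reading
vanishes, `z` kills `S[p^{n+1}]`, hence `z = z'' ∘ p^{n+1}` (`exists_eq_comp_nsmul_of_forall_pTorsion` for
the integer `p^{n+1}`), i.e. `z ∈ p^{n+1} X`.  So `p^n X / p^{n+1} X ↪ Maps((p^n S)[p], ℚ/ℤ[p])`.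
The case `n = 0` is `finite_quotient_pSmul_of_finite_pTorsion`. [cite: GreenbergLNM1716, §1 p. 60 (after Conj. 1.3)] -/
theorem finite_gradedQuotient_of_finite (hbij : Function.Bijective toDual)
    (hC : ∀ (c : ℤ_[p]) (x : X) (s : S) (k : ℕ), p ^ k • s = 0 →
      toDual (PowerSeries.C c • x) s = (PadicInt.toZModPow k c).val • toDual x s)
    (htor : ∀ s : S, ∃ k : ℕ, p ^ k • s = 0) (n : ℕ)
    (hfin : {s : S | p • s = 0 ∧ ∃ t : S, p ^ n • t = s}.Finite) :
    Finite (↥(Ideal.span {PowerSeries.C (p : ℤ_[p])} ^ n • (⊤ : Submodule (PowerSeries ℤ_[p]) X)) ⧸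
      (Ideal.span {PowerSeries.C (p : ℤ_[p])} •
        (⊤ : Submodule (PowerSeries ℤ_[p])
          ↥(Ideal.span {PowerSeries.C (p : ℤ_[p])} ^ n • (⊤ : Submodule (PowerSeries ℤ_[p]) X))))) := by
  classical
  set Cp : PowerSeries ℤ_[p] := PowerSeries.C (p : ℤ_[p]) with hCp
  set N : Submodule (PowerSeries ℤ_[p]) X := Ideal.span {Cp} ^ n • ⊤ with hN
  -- the finite source set `(p^n S)[p]` and the finite target `ℚ/ℤ[p]`
  set Tn : Set S := {s : S | p • s = 0 ∧ ∃ t : S, p ^ n • t = s} with hTn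
  haveI : Finite Tn := hfin.to_subtype
  have hT : {u : AddCircle (1 : ℚ) | p • u = 0}.Finite :=
    AddCircle.finite_torsion (1 : ℚ) (Fact.out : p.Prime).pos
  haveI : Finite {u : AddCircle (1 : ℚ) | p • u = 0} := hT.to_subtype
  -- a chosen `p^n`-th root `t_s` of every `s ∈ Tn`
  have hroot : ∀ s : Tn, ∃ t : S, p ^ n • t = (s : S) := fun s ↦ s.2.2
  choose root hroot using hroot
  -- every `z ∈ N` is `(C p)^n • z'`, and `toDual z t` depends only on `p^n • t`
  have hdep : ∀ z : N, ∀ t t' : S, p ^ n • t = p ^ n • t' →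
      toDual (z : X) t = toDual (z : X) t' := by
    intro z t t' htt'
    obtain ⟨z', hz'⟩ := exists_eq_C_pow_smul_of_mem z.2
    rw [hz', toDual_C_pow_smul hC htor, toDual_C_pow_smul hC htor, htt']
  -- the reading map `ρ : N → (Tn → ℚ/ℤ[p])`
  let ρ : N → (Tn → {u : AddCircle (1 : ℚ) | p • u = 0}) := fun z s ↦
    ⟨toDual (z : X) (root s), by
      obtain ⟨z', hz'⟩ := exists_eq_C_pow_smul_of_mem z.2
      change p • toDual (z : X) (root s) = 0
      rw [hz', toDual_C_pow_smul hC htor, hroot s, ← map_nsmul, s.2.1, map_zero]⟩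
  have hρ : ∀ (z : N) (s : Tn), ((ρ z s : {u : AddCircle (1 : ℚ) | p • u = 0}) : AddCircle (1 : ℚ)) =
      toDual (z : X) (root s) := fun z s ↦ rfl
  -- KEY: a class of `N` read as zero on `Tn` lies in `(C p) • N`
  set P : Submodule (PowerSeries ℤ_[p]) N := Ideal.span {Cp} • ⊤ with hP
  have hkey : ∀ z : N, (∀ s : Tn, toDual (z : X) (root s) = 0) → z ∈ P := by
    intro z hz
    -- `toDual z` kills `S[p^{n+1}]`
    have hkill : ∀ t : S, p ^ (n + 1) • t = 0 → toDual (z : X) t = 0 := by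
      intro t ht
      have hs : p ^ n • t ∈ Tn := by
        refine ⟨?_, t, rfl⟩
        rw [← mul_smul, ← pow_succ', ht]
      rw [hdep z t (root ⟨_, hs⟩) (hroot ⟨_, hs⟩).symm]
      exact hz ⟨_, hs⟩
    -- hence `toDual z = χ' ∘ p^{n+1}` with `χ' = toDual z''`
    obtain ⟨χ', hχ'⟩ := exists_eq_comp_nsmul_of_forall_pTorsion (p := p ^ (n + 1)) (toDual (z : X)) hkill
    obtain ⟨z'', hz''⟩ := hbij.2 χ'
    have hzX : (z : X) = Cp ^ (n + 1) • z'' := by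
      refine hbij.1 ?_
      ext t
      rw [hχ' t, ← hz'', toDual_C_pow_smul hC htor]
    -- `Cp^{n+1} • z'' = Cp • (Cp^n • z'')` with `Cp^n • z'' ∈ N`
    let w : N := ⟨Cp ^ n • z'', C_pow_smul_mem n z''⟩
    have hzw : z = Cp • w := by
      apply Subtype.ext
      rw [Submodule.coe_smul, hzX]
      change Cp ^ (n + 1) • z'' = Cp • (Cp ^ n • z'')
      rw [← mul_smul, ← pow_succ']
    rw [hzw, hP]
    exact Submodule.smul_mem_smul (Ideal.mem_span_singleton_self _) Submodule.mem_top
  -- and conversely classes of `(C p) • N` read as zero on `Tn`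
  have hPann : ∀ z ∈ P, ∀ s : Tn, toDual (z : X) (root s) = 0 := by
    intro z hz s
    rw [hP, Submodule.ideal_span_singleton_smul, Submodule.mem_smul_pointwise_iff_exists] at hz
    obtain ⟨w, -, hw⟩ := hz
    obtain ⟨w', hw'⟩ := exists_eq_C_pow_smul_of_mem w.2
    rw [← hw, Submodule.coe_smul, hw', ← mul_smul, ← pow_succ', toDual_C_pow_smul hC htor,
      pow_succ', mul_smul, hroot s, s.2.1, map_zero]
  -- `ρ x = ρ y ⟹ x - y ∈ P`
  have hinj : ∀ x y : N, ρ x = ρ y → x - y ∈ P := by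
    intro x y hxy
    refine hkey (x - y) fun s ↦ ?_
    have := congrArg (fun f ↦ ((f s : {u : AddCircle (1 : ℚ) | p • u = 0}) : AddCircle (1 : ℚ))) hxy
    simp only [hρ] at this
    rw [Submodule.coe_sub, map_sub, AddMonoidHom.sub_apply, this, sub_self]
  -- hence `N ⧸ P` injects into the finite function type
  refine Finite.of_injective (fun q : N ⧸ P ↦ Quotient.liftOn' q ρ ?_) ?_
  · intro x y hxy
    have hxyP : x - y ∈ P := (Submodule.quotientRel_def P).mp hxy
    funext s
    apply Subtype.ext
    rw [hρ, hρ, ← sub_eq_zero, ← AddMonoidHom.sub_apply, ← map_sub, ← Submodule.coe_sub]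
    exact hPann _ hxyP s
  · intro q₁ q₂ hq
    induction q₁ using Quotient.inductionOn' with | h x => ?_
    induction q₂ using Quotient.inductionOn' with | h y => ?_
    exact (Submodule.Quotient.eq P).mpr (hinj x y hq)

end Graded

end Literature.NumberTheory.EllipticCurves.IwasawaDual

/-! ## Part 2 — the dual fine Selmer datum, graded -/

namespace WeierstrassCurve

open Literature.NumberTheory.EllipticCurves Literature.NumberTheory.GaloisRepresentations Field

universe u

variable {K : Type u} [Field K] [NumberField K] {W : WeierstrassCurve K} {p : ℕ} [Fact p.Prime]
  {κ : ZpExtension K p}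

/-- **`(p^n Sel₀)[p]` finite ⟹ `p^n X₀ / p^{n+1} X₀` finite** for every dual fine Selmer datum (graded
form of `finite_quotient_augIdealP_of_finite_pTorsion`; `(p) = augIdealP p`).
[cite: GreenbergLNM1716, §1 p. 60 (after Conj. 1.3)] -/
theorem FineSelmerDualData.finite_gradedQuotient_of_finite_gradedPTorsion {γ : absoluteGaloisGroup K}
    (Y : W.FineSelmerDualData κ γ) (n : ℕ)
    (hfin : Set.Finite {s : W.fineSelmerInfty κ |
      p • s = 0 ∧ ∃ t : W.fineSelmerInfty κ, p ^ n • t = s}) :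
    Finite (↥((IwasawaAlgebra.augIdealP p ^ n) • (⊤ : Submodule (IwasawaAlgebra p) Y.X)) ⧸
      (IwasawaAlgebra.augIdealP p •
        (⊤ : Submodule (IwasawaAlgebra p)
          ↥((IwasawaAlgebra.augIdealP p ^ n) • (⊤ : Submodule (IwasawaAlgebra p) Y.X))))) :=
  IwasawaDual.finite_gradedQuotient_of_finite Y.bijective Y.toDual_C_smul
    exists_pow_smul_fineSelmerInfty_eq_zero n hfin

/-- **Graded reduction: if `(conj_γ − id)^J` kills every `y ∈ H¹(K_∞, E[p])` whose image lies in
`p^n · Sel₀(K_∞, E[p^∞])`, then `(p^n Sel₀)[p]` is finite** (graded form of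
`finite_fineSelmerInfty_pTorsion_of_forall_iterate_eq_zero`: Kummer lift `exists_torsionToPrimaryH1Sub_eq`
+ `finite_setOf_fineLift_iterate_eq_zero`). [cite: GreenbergLNM1716, §1 p. 60 (after Conj. 1.3)] -/
theorem finite_fineSelmerInfty_gradedPTorsion_of_forall_iterate_eq_zero [W.IsElliptic]
    {γ : absoluteGaloisGroup K} (hγ : κ.IsTopGenerator γ) {J n : ℕ}
    (hJ : ∀ y : Literature.NumberTheory.EllipticCurves.subgroupH1 κ.kerSubgroup (geomTorsion W (p : ℤ)),
      (∃ t : W.fineSelmerInfty κ,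
        W.torsionToPrimaryH1Sub p κ.kerSubgroup y = p ^ n • (t : W.subgroupH1 p κ.kerSubgroup)) →
        (⇑(Literature.NumberTheory.EllipticCurves.conjH1 κ.kerSubgroup (geomTorsion W (p : ℤ)) γ -
            AddMonoidHom.id (Literature.NumberTheory.EllipticCurves.subgroupH1 κ.kerSubgroup
              (geomTorsion W (p : ℤ)))))^[J] y = 0) :
    Set.Finite {s : W.fineSelmerInfty κ | p • s = 0 ∧ ∃ t : W.fineSelmerInfty κ, p ^ n • t = s} := by
  classical
  let ιN := W.torsionToPrimaryH1Sub p κ.kerSubgroup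
  have hL := W.finite_setOf_fineLift_iterate_eq_zero κ hγ J
  refine ((hL.image ιN).preimage (Subtype.val_injective.injOn)).subset ?_
  rintro s ⟨hs, t, hts⟩
  have hps : p • (s : W.subgroupH1 p κ.kerSubgroup) = 0 := by
    rw [← AddSubgroupClass.coe_nsmul, hs, ZeroMemClass.coe_zero]
  obtain ⟨y, hy⟩ := W.exists_torsionToPrimaryH1Sub_eq p (H := κ.kerSubgroup)
    W.zsmul_geomPoints_surjective_holds hps
  have hyS : ιN y ∈ W.fineSelmerInfty κ := by
    rw [show ιN y = (s : W.subgroupH1 p κ.kerSubgroup) from hy]; exact s.2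
  have hyn : ∃ t : W.fineSelmerInfty κ, ιN y = p ^ n • (t : W.subgroupH1 p κ.kerSubgroup) :=
    ⟨t, by rw [show ιN y = (s : W.subgroupH1 p κ.kerSubgroup) from hy, ← hts, AddSubgroupClass.coe_nsmul]⟩
  exact ⟨y, ⟨hyS, hJ y hyn⟩, hy⟩

end WeierstrassCurve

end
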